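import Summits.CriticalPhenomena.PercolationContinuityZ3.Theses.PercNearOneGluing
import Summits.CriticalPhenomena.PercolationContinuityZ3.Theorems.PercNearOneGluingNearOneGluingFreshPocketAveraging
import Summits.CriticalPhenomena.PercolationContinuityZ3.Theorems.PercNearOneGluingNearOneGluingMultiCopyFootprint
import Literature.Probability.Percolation.PercolationProofs
import HarnessLib.Audit

/-!
# Line `independent-bad-world` — skeleton for the crux `PercNearOneGluing.NearOneGluing`
(crux item stmt-CriticalPhenomena-4574 = Kozma–Nitzan Conjecture 3 typed over all finite weighted graphs;
route `route-CriticalPhenomena-PercNearOneGluing`, rank 3; idea card `Cruxes/NearOneGluing/Ideas/independent-bad-world.md`;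
triage r1 k = 1, 2, 3: pass / pass (line thin) / pass; crux-plan by
planner-cruxplan-stmt-CriticalPhenomena-4574-independent-bad-worl-0, 2026-08-15.)

Crux (FIXED, by name): `∀ ε > 0 ∃ δ > 0 ∀ n w A o b, P(o ↔ A) > 1 − δ → (∀ a ∈ A, P(a ↔ b) > 1 − δ) → P(o ↔ b) > 1 − ε`
for the product Bernoulli measure `prodBernoulli w` on bond configurations of the complete weighted graph on `Fin n`
(`Literature.Probability.LatticeModels.prodBernoulli`, events `Literature.Probability.Percolation.openConn`).

Notation used in the docstrings: `μ = prodBernoulli w`; `B = {o ↮ b}`, `u = μ(B)`; `C(b) = openCluster · b`;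
`π(K) = μ(C(b) = K)` (the cluster law of `b`; `Σ_{K ∌ o} π(K) = u`); for a vertex set `X`, `D(X) = μ(o ↮ X)`;
`N = |C(o) ∩ A|` (the footprint, `(A.filter (o ↔ ·)).card`); `δ` = a common upper bound of `μ(o ↮ A)` and of
`max_{a ∈ A} μ(a ↮ b)`.

## The line in one paragraph
Condition on the whole bad cluster `K = C(b) ∌ o`: off `K` the configuration is FRESH (spatial Markov), and deleting `K`
only destroys connections (graph monotonicity), so `Σ_{K ∌ o} π(K) · D(X ∖ K) ≤ μ(o ↮ X, B)` for every vertex set `X`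
(stub 1). Iterating this against `j` INDEPENDENT bad worlds `K₁, …, K_j ∼ π` and counting transversals (`R = C(o) ∩ A`
must meet the `δ^j`-sparse set `A ∖ (K₁ ∪ … ∪ K_j)`) gives the multi-copy large-footprint lemma
`(1 − θ) · u^j · μ(B, N·δ^j < θ·u^j) ≤ δ` for every `j` (stub 2; `j = 1` is the card's LargeFootprint, sharpened from
`2√δ/(√u(1−θ))` to `δ/((1−θ)u)`). Hence in any would-be counterexample the pocket of `o`, when cut from `b`, carries
`≥ ½ (u/δ)^j` relay points for EVERY fixed `j` — the footprint is super-polynomial in `u/δ` — and all that is left of the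
crux is the rarity of such GIANT pockets: `u^j · μ(B, u^j ≤ 2N·δ^j) ≤ C δ^κ` for some `j, C, κ > 0` (stub 3, the open
residual; it is implied by the route's linear proxy AdditiveGluing (stmt-4576) with `j = 0, κ = 1, C = 2` and by KN
Conjecture 1 with `C = 3`, and it is where the `|A|`-uniformity of the crux now lives). The composition `NearOneGluing_of` is the real proof
`u^{j+1} ≤ u^j μ(E₁) + u^j μ(E₂) ≤ 2δ + Cδ^κ < ε^{j+1}` for `δ := min(1, ε^{j+1}/4, (ε^{j+1}/(4C))^{1/κ})`.

## Stubs (3, registered; all stated over existing Literature / route declarations only)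
* `stub_freshPocketAveraging` — spatial Markov for `C(b)` + monotonicity of `openConn` in the graph, averaged over the
  cluster law: `Σ_{K ∌ o} π(K)·D(X∖K) ≤ μ(o ↮ X, o ↮ b)` for every `X`. (M–L: cluster-cylinder decomposition
  `{C(b) = K} = {K spanned from b inside K} ∩ {∂_E K closed}` as in `prodBernoulli_real_openCluster_eq`, but for
  the complete graph with possibly positive loop weights `w s(x,x)` (loops never open an adjacency: `openGraph_adj`);
  independence of events determined by disjoint coordinate sets `prodBernoulli_real_inter_of_determinedBy_disjoint`;
  `openConnIn Kᶜ o a ⊆ openConn o a`.) Exact check: equality up to 3e-16 on 1380 random weighted graphs, n ≤ 6.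
* `stub_multiCopyFootprint` — GIVEN stub 1 for the instance (hypothesis, by statement), for every `j : ℕ`, `θ ∈ (0,1)`:
  `(1−θ)·u^j·μ{B ∧ N δ^j < θ u^j} ≤ δ`. (M–L, pure finite sums: with `D_i := Σ_{K₁..K_i ∌ o} π(K₁)⋯π(K_i)·D(A∖(K₁∪…∪K_i))`,
  stub 1 gives `D_i ≤ D_{i−1} ≤ … ≤ D₀ = D(A) ≤ δ`; with `W_j(ω) := Σ_{K₁..K_j ∌ o} π⋯π·1{R_ω ∩ (A∖∪K_i) ≠ ∅}` one has
  pointwise `W_j ≤ min(u^j, Σ_{a ∈ R_ω} μ(B, a ∉ C(b))^j) ≤ min(u^j, N_ω δ^j)` and, summing `μ(B, R ∩ Y ≠ ∅) ≥ u − D(Y)`,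
  `E[1_B W_j] ≥ u^{j+1} − D_j ≥ u^{j+1} − δ`; finally `E[1_B min(u^j, Nδ^j)] ≤ u^{j+1} − (1−θ)u^j μ(B, Nδ^j < θu^j)`.)
  Exact check: 0 violations, max `(1−θ)u^j μ(…)/δ = 0.90` (j = 0..4, θ ∈ {.1,…,.9}), 1380 instances n ≤ 6 + hand gadgets.
* `stub_giantPocketsRare` — HARDEST (open-problem grade; the residual shared with the BHK-thinning line's
  "VerticalBudget above k₀"): `∃ j C κ > 0`, for all instances and all admissible `δ ≤ 1`:
  `u^j · μ{B ∧ u^j ≤ 2 N δ^j} ≤ C δ^κ`.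
* `NearOneGluing_of : NearOneGluing` — the kernel-checked composition (uses the three stubs; real proof).

## Disproof used (cdisprove v1–v5 on the item; the `Disproof.lean` bodies under run/gate/evidence are not mounted in
planner seats — read through the evidence notes, as the triagers did; no `Negative/` lemma has landed)
`nearOneGluing_false_without_relay` / `_without_reliability`: honoured — stub 2 spends BOTH hypotheses (`D(A) ≤ δ` in
`D_j ≤ δ`, reliability in `W_j ≤ Nδ^j`), stub 3 carries both as hypotheses. `nearOneGluing_of_card_le`,
`nearOneGluing_of_mean_le`: superseded as counterexample floors by the corollaries below (footprint `≥ ½(u/δ)^j` a.s.-ish,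
`E N ≥ ¼(ε/δ)^{j+1}`). `unionBound_rate_sharp` (no `δ = cε`, `c > 1/2`): the composition's rate is `δ ≍ ε^{j+1}`, no
conflict. `not_nearOneGluingLossless`, `nearOneGluing_depth_one`, `real_offConn_compl_mul_le` (deletion-form twin of the
pointwise sparsity `μ(B, a ∉ C(b)) ≤ δ` used in `W_j`), `iff_nearOneGluing` (4575 ⇔ crux): consistent, nothing reused.
No stub is an instance of a refuted statement (`ledger negatives`: 7 items, none on finite-graph gluing).

## Not in the composition (corollaries recorded in the line card, provable from stubs 1–2 + Markov/Harris)
(a) counterexample anatomy: `μ(B, N < ½(u/δ)^j) ≤ 2δ/u^j` for every `j`; (b) BHK-free quasi-polynomial range: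
`u^{j+1} ≤ 2δ + 2δ^j·E[N; B] ≤ 2δ + 2δ^{j+1} Σ_a μ(o ↔ a)` for every `j`, so the crux holds uniformly over
`log |A| ≤ c·log(1/δ)·log(ε/δ)/log(1/ε)`; (c) the card's per-scale GEOMETRIC DECAY form of K2 is FALSE (hub gadget
`o —(1−s)— h ≡ {a₁..a_m} —(1−t)— b`: all bad mass `(1−s)t` sits at the single scale `m`, arbitrary) — only the summed
form (stub 3) survives.
-/

/-!
## Lead's note (prover-line-stmt-CriticalPhenomena-4574-0, 2026-08-16): stubs 1–2 are LANDED
(`Theorems.freshPocketAveraging` p73580, `Theorems.multiCopyFootprint` p73463, proved during the lead's wave 2 as tooling for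
line bhk-dyadic-thinning) and wired in below; the only sorry left is `stub_giantPocketsRare` (the residual, a polynomial-rate
STRENGTHENING of the crux).
-/

namespace Summit.CriticalPhenomena.PercolationContinuityZ3.Cruxes.NearOneGluing.IndependentBadWorld

open MeasureTheory Literature.Probability.LatticeModels Literature.Probability.Percolation
open scoped Classical BigOperators

/-! ## Stub 1 — fresh-pocket averaging (the lever: spatial Markov for `C(b)` + graph monotonicity) -/

/-- STUB 1 (size M–L; sources: Grimmett1999 §1.3 (product structure), van den Berg–Häggström–Kahn 2006
= doi:10.1002/rsa.20102 Lemma 2.3 with q = 1 ("given `C_A = F`, the configuration off `F̄` is percolation on `G − F̄`"),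
tree `Literature.Probability.LatticeModels.prodBernoulli_real_openCluster_eq` (cluster cylinder formula),
`prodBernoulli_real_inter_of_determinedBy_disjoint`, `Literature.Probability.Percolation.openConnIn`).
**Fresh-pocket averaging.** For every vertex set `X`:
`Σ_{K ∌ o} μ(C(b) = K) · μ(o ↮ X ∖ K) ≤ μ(o ↮ X ∧ o ↮ b)`.
Proof route: for `K ∌ o`, `{C(b) = K} ∩ {o ↮ X} = {C(b) = K} ∩ {∀ a ∈ X∖K, ¬ openConnIn Kᶜ o a}` (on `C(b) = K` the
open cluster of `o` avoids `K`); the two events are determined by disjoint sets of pairs (pairs meeting `K` / pairs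
inside `Kᶜ`), hence independent under the product measure; and `openConnIn Kᶜ o a ⊆ openConn o a` gives
`μ(o ↮ X∖K) ≤ μ(∀ a ∈ X∖K, ¬ openConnIn Kᶜ o a)`; sum over `K ∌ o` (the events `{C(b) = K}` partition `{o ↮ b}`).
Terms with `b ∉ K` vanish. Loops `s(x,x)` may carry weight but never create adjacencies (`openGraph_adj`). -/
theorem stub_freshPocketAveraging :
    ∀ (n : ℕ) (w : Sym2 (Fin n) → unitInterval) (X : Finset (Fin n)) (o b : Fin n),
      ∑ K ∈ (Finset.univ : Finset (Finset (Fin n))).filter (fun K => o ∉ K),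
          (prodBernoulli w).real {ω | openCluster ω b = (K : Set (Fin n))} *
            (prodBernoulli w).real (⋃ a ∈ X \ K, openConn o a)ᶜ
        ≤ (prodBernoulli w).real ((⋃ a ∈ X, openConn o a)ᶜ ∩ (openConn o b)ᶜ) :=
  Summit.CriticalPhenomena.PercolationContinuityZ3.Theorems.freshPocketAveraging

/-! ## Stub 2 — the multi-copy large-footprint lemma (independent bad worlds + transversal counting) -/

/-- STUB 2 (size M–L; sources: card `Ideas/independent-bad-world.md` steps (a)–(c) (j = 1, with an unnecessary Markov
split that this statement removes), KozmaNitzan2024 = arXiv:2401.12397 p.15 (the crux), Harris-free).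
**Multi-copy footprint lemma.** Assume fresh-pocket averaging for the instance (the displayed hypothesis = the
statement of `stub_freshPocketAveraging` at `n, w, o, b`, for every `X`). Then for every `j : ℕ`, `δ > 0`, `θ ∈ (0,1)`
with `μ(o ↮ A) ≤ δ` and `μ(a ↮ b) ≤ δ` for all `a ∈ A`:
`(1 − θ) · u^j · μ{ω ∉ {o ↔ b} ∧ N(ω)·δ^j < θ·u^j} ≤ δ`, where `u = μ(o ↮ b)`, `N(ω) = |{a ∈ A | o ↔ a}|`.
Proof route (finite sums only; `π(K) = μ(C(b) = K)` on `K ∌ o`, `D(X) = μ(o ↮ X)`):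
(i) `D_i := Σ_{K₁,…,K_i ∌ o} π(K₁)⋯π(K_i) D(A ∖ (K₁ ∪ … ∪ K_i))` satisfies `D_i ≤ D_{i−1}` (hypothesis with
`X = A ∖ (K₁ ∪ … ∪ K_{i−1})`, and `μ(o ↮ X, B) ≤ D(X)`), so `D_j ≤ D(A) ≤ δ`;
(ii) `W_j(ω) := Σ_{K₁..K_j ∌ o} π⋯π · 1{∃ a ∈ A ∖ ∪K_i, o ↔ a}` obeys `Σ_ω μ(ω) 1_B(ω) W_j(ω) = Σ π⋯π μ(B ∧ o ↔ A∖∪K_i)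
≥ Σ π⋯π (u − D(A∖∪K_i)) = u^{j+1} − D_j ≥ u^{j+1} − δ` (on `B`, `o ↮ Y` iff `C(o) ∩ A ∩ Y = ∅`);
(iii) pointwise on `B`: `W_j(ω) ≤ Σ_{a : o ↔ a} (Σ_{K ∌ o, K ∌ a} π(K))^j = Σ_{a ∈ R_ω} μ(B ∧ a ∉ C(b))^j ≤ N(ω)·δ^j`
and `W_j ≤ u^j`; (iv) so `u^{j+1} − δ ≤ E[1_B min(u^j, N δ^j)] ≤ u^{j+1} − (1−θ) u^j μ(B ∧ Nδ^j < θu^j)`.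
`j = 1` is the card's LargeFootprint with the linear constant `δ/((1−θ)u)`; exact enumeration (planner, 1380 random
weighted graphs on ≤ 6 vertices + hub/two-hub/pocket gadgets, j ≤ 4): 0 violations, max LHS/δ = 0.90. -/
theorem stub_multiCopyFootprint :
    ∀ (n : ℕ) (w : Sym2 (Fin n) → unitInterval) (A : Finset (Fin n)) (o b : Fin n),
      (∀ X : Finset (Fin n),
        ∑ K ∈ (Finset.univ : Finset (Finset (Fin n))).filter (fun K => o ∉ K),
            (prodBernoulli w).real {ω | openCluster ω b = (K : Set (Fin n))} *
              (prodBernoulli w).real (⋃ a ∈ X \ K, openConn o a)ᶜ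
          ≤ (prodBernoulli w).real ((⋃ a ∈ X, openConn o a)ᶜ ∩ (openConn o b)ᶜ)) →
      ∀ (j : ℕ) (δ θ : ℝ), 0 < δ → 0 < θ → θ < 1 →
        (prodBernoulli w).real (⋃ a ∈ A, openConn o a)ᶜ ≤ δ →
        (∀ a ∈ A, (prodBernoulli w).real (openConn a b)ᶜ ≤ δ) →
        (1 - θ) * ((prodBernoulli w).real (openConn o b)ᶜ) ^ j *
            (prodBernoulli w).real {ω | ω ∉ openConn o b ∧
              ((A.filter fun a => ω ∈ openConn o a).card : ℝ) * δ ^ j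
                < θ * ((prodBernoulli w).real (openConn o b)ᶜ) ^ j} ≤ δ :=
  Summit.CriticalPhenomena.PercolationContinuityZ3.Theorems.multiCopyFootprint

/-! ## Stub 3 — HARDEST: giant pockets cut from `b` are polynomially rare (the open residual) -/

/-- STUB 3 — HARDEST (open-problem grade; sources: KozmaNitzan2024 = arXiv:2401.12397 Conj 1 p.3 / Conj 3 p.15 (Conj 1
⇒ this with `j = 0, C = 3, κ = 1` via cdisprove-4575's `linearForm_three_of_KNConjecture1`), route items AdditiveGluing
(stmt-CriticalPhenomena-4576, implies it with `j = 0, C = 2, κ = 1`) and NoHeavyLowerTail (stmt-4575); triage r1-2/r1-3: it is the summed "VerticalBudget restricted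
to scales `≥ log₂(u/2δ)`" of line bhk-dyadic-thinning, here with the threshold pushed to `½(u/δ)^j` for a free `j` and a
free polynomial rate; BarrierSharedBit.md: it FAILS in the shared-bit model (u ≈ 0.39 at δ → 0), as every statement
carrying the |A|-uniformity must, so its proof has to spend edge-independence).
**Giant pockets are rare.** There are `j : ℕ` and `C, κ > 0` such that on every finite weighted graph, for every
admissible level `0 < δ ≤ 1` (`μ(o ↮ A) ≤ δ`, `μ(a ↮ b) ≤ δ ∀ a ∈ A`):
`u^j · μ{ω ∉ {o ↔ b} ∧ u^j ≤ 2·N(ω)·δ^j} ≤ C·δ^κ`   (`u = μ(o ↮ b)`).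
Reading through stub 1 (fresh-pocket form, equal by spatial Markov): `Σ_{K ∌ o} π(K) · μ_{fresh on G∖K}(the pocket of o
captures ≥ ½(u/δ)^j points of A∖K)` is polynomially small — `K = C(b)` must avoid, at non-negligible `π`-cost, a region in
which `o` percolates to super-polynomially many individually `(1−δ)`-reliable relay points. Why it might fail: it is
the crux with a polynomial rate on its residual event (no `|A|`, no `E N`); a gadget family simulating shared bits
(many far edges driven by one bottleneck without shared connectivity) with bad mass ≫ δ^κ at footprints ≫ (u/δ)^j for
all j would kill it — none is known (KN §5.7's directed example and bunkbed gadgets arXiv:2410.02545 do not reach it). -/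
theorem stub_giantPocketsRare :
    ∃ (j : ℕ) (C κ : ℝ), 0 < C ∧ 0 < κ ∧
      ∀ (n : ℕ) (w : Sym2 (Fin n) → unitInterval) (A : Finset (Fin n)) (o b : Fin n) (δ : ℝ),
        0 < δ → δ ≤ 1 →
        (prodBernoulli w).real (⋃ a ∈ A, openConn o a)ᶜ ≤ δ →
        (∀ a ∈ A, (prodBernoulli w).real (openConn a b)ᶜ ≤ δ) →
        ((prodBernoulli w).real (openConn o b)ᶜ) ^ j *
          (prodBernoulli w).real {ω | ω ∉ openConn o b ∧
            ((prodBernoulli w).real (openConn o b)ᶜ) ^ j ≤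
              2 * ((A.filter fun a => ω ∈ openConn o a).card : ℝ) * δ ^ j} ≤ C * δ ^ κ := by
  sorry

/-! ## The composition: stubs 1–3 give the crux BY NAME -/

/-- **`NearOneGluing` from the line `independent-bad-world`.** Real proof (ε–δ bookkeeping + the power algebra): take
`j, C, κ` from `stub_giantPocketsRare`, put `η := ε^{j+1}` and `δ := min(1, η/4, (η/(4C))^{1/κ})`; for an instance
satisfying the crux hypotheses at level `δ`, split `{o ↮ b} ⊆ E₁ ∪ E₂` with `E₁ = {o ↮ b, Nδ^j < ½u^j}` (stub 2 at
`θ = ½`, fed with stub 1: `½ u^j μ(E₁) ≤ δ`) and `E₂ = {o ↮ b, u^j ≤ 2Nδ^j}` (stub 3: `u^j μ(E₂) ≤ Cδ^κ ≤ η/4`); then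
`u^{j+1} ≤ u^j μ(E₁) + u^j μ(E₂) ≤ 2δ + Cδ^κ < ε^{j+1}`, so `u < ε` and `μ(o ↔ b) = 1 − u > 1 − ε`. -/
theorem NearOneGluing_of :
    Summit.CriticalPhenomena.PercolationContinuityZ3.Theses.PercNearOneGluing.NearOneGluing := by
  obtain ⟨j, C, κ, hC, hκ, hT⟩ := stub_giantPocketsRare
  intro ε hε
  -- the target level η = ε^(j+1) and the choice of δ
  set η : ℝ := ε ^ (j + 1) with hη
  have hη0 : 0 < η := pow_pos hε _
  set δ : ℝ := min 1 (min (η / 4) ((η / (4 * C)) ^ (1 / κ))) with hδ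
  have hbase : 0 < η / (4 * C) := by positivity
  have hδ0 : 0 < δ := lt_min one_pos (lt_min (by positivity) (Real.rpow_pos_of_pos hbase _))
  have hδ1 : δ ≤ 1 := min_le_left _ _
  have hδη : δ ≤ η / 4 := (min_le_right _ _).trans (min_le_left _ _)
  have hδr : δ ≤ (η / (4 * C)) ^ (1 / κ) := (min_le_right _ _).trans (min_le_right _ _)
  refine ⟨δ, hδ0, ?_⟩
  intro n w A o b hoA hAb
  -- notation
  set μ := prodBernoulli w with hμ
  set u : ℝ := μ.real (openConn o b)ᶜ with hu
  have hmeas : MeasurableSet (openConn o b : Set (BondConfig (Fin n))) := measurableSet_openConn_holds o b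
  have hmeasA : MeasurableSet (⋃ a ∈ A, (openConn o a : Set (BondConfig (Fin n)))) :=
    Finset.measurableSet_biUnion A fun a _ => measurableSet_openConn_holds o a
  have hu0 : 0 ≤ u := measureReal_nonneg
  have hu1 : u ≤ 1 := by
    rw [hu, probReal_compl_eq_one_sub hmeas]
    linarith [measureReal_nonneg (μ := μ) (s := openConn o b)]
  -- the hypotheses in `≤ δ` form
  have h1 : μ.real (⋃ a ∈ A, openConn o a)ᶜ ≤ δ := by
    rw [probReal_compl_eq_one_sub hmeasA]
    linarith
  have h2 : ∀ a ∈ A, μ.real (openConn a b)ᶜ ≤ δ := by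
    intro a ha
    rw [probReal_compl_eq_one_sub (measurableSet_openConn_holds a b)]
    linarith [hAb a ha]
  -- the two pieces of the bad event
  set E₁ : Set (BondConfig (Fin n)) := {ω | ω ∉ openConn o b ∧
      ((A.filter fun a => ω ∈ openConn o a).card : ℝ) * δ ^ j < (1 / 2) * u ^ j} with hE₁
  set E₂ : Set (BondConfig (Fin n)) := {ω | ω ∉ openConn o b ∧
      u ^ j ≤ 2 * ((A.filter fun a => ω ∈ openConn o a).card : ℝ) * δ ^ j} with hE₂
  have hK : (1 - 1 / 2) * u ^ j * μ.real E₁ ≤ δ :=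
    stub_multiCopyFootprint n w A o b (fun X => stub_freshPocketAveraging n w X o b) j δ (1 / 2) hδ0
      (by norm_num) (by norm_num) h1 h2
  have hTT : u ^ j * μ.real E₂ ≤ C * δ ^ κ := hT n w A o b δ hδ0 hδ1 h1 h2
  have hcover : (openConn o b : Set (BondConfig (Fin n)))ᶜ ⊆ E₁ ∪ E₂ := by
    intro ω hω
    by_cases h : ((A.filter fun a => ω ∈ openConn o a).card : ℝ) * δ ^ j < (1 / 2) * u ^ j
    · exact Or.inl ⟨hω, h⟩
    · refine Or.inr ⟨hω, ?_⟩
      have h' := not_lt.mp h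
      linarith
  have husplit : u ≤ μ.real E₁ + μ.real E₂ :=
    (measureReal_mono hcover).trans (measureReal_union_le E₁ E₂)
  -- u^(j+1) ≤ 2δ + C δ^κ
  have hE₁0 : 0 ≤ μ.real E₁ := measureReal_nonneg
  have hE₂0 : 0 ≤ μ.real E₂ := measureReal_nonneg
  have huj0 : 0 ≤ u ^ j := pow_nonneg hu0 _
  have hpow : u ^ (j + 1) ≤ 2 * δ + C * δ ^ κ := by
    have hK' : u ^ j * μ.real E₁ ≤ 2 * δ := by nlinarith
    calc u ^ (j + 1) = u ^ j * u := pow_succ u j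
      _ ≤ u ^ j * (μ.real E₁ + μ.real E₂) := by gcongr
      _ = u ^ j * μ.real E₁ + u ^ j * μ.real E₂ := by ring
      _ ≤ 2 * δ + C * δ ^ κ := add_le_add hK' hTT
  -- smallness of the right-hand side
  have hrpow : C * δ ^ κ ≤ η / 4 := by
    have h1' : δ ^ κ ≤ ((η / (4 * C)) ^ (1 / κ)) ^ κ :=
      Real.rpow_le_rpow hδ0.le hδr hκ.le
    have h2' : ((η / (4 * C)) ^ (1 / κ)) ^ κ = η / (4 * C) := by
      rw [← Real.rpow_mul hbase.le, one_div_mul_cancel hκ.ne', Real.rpow_one]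
    rw [h2'] at h1'
    calc C * δ ^ κ ≤ C * (η / (4 * C)) := by gcongr
      _ = η / 4 := by field_simp
  have hlt : u ^ (j + 1) < ε ^ (j + 1) := by
    have : 2 * δ + C * δ ^ κ < η := by linarith
    rw [hη] at this
    exact hpow.trans_lt this
  have huε : u < ε := lt_of_pow_lt_pow_left₀ (j + 1) hε.le hlt
  -- conclusion
  have : μ.real (openConn o b) = 1 - u := by
    rw [hu, probReal_compl_eq_one_sub hmeas]; ring
  rw [this]
  linarith

end Summit.CriticalPhenomena.PercolationContinuityZ3.Cruxes.NearOneGluing.IndependentBadWorld
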